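import Literature.NumberTheory.LFunctions.Zhang2022.RepairRplus
import Literature.NumberTheory.LFunctions.Zhang2022.KnifeEdgeEStarLen
import Literature.NumberTheory.LFunctions.Zhang2022.Section11Deductions

/-!
# Zhang (2022), rung F-S3 (Landau–Siegel programme), sub-cell E: the TRIVIAL SCALE `discWeight` evaluated from the
# manuscript's own mean-value nodes — `discWeight = (8/π)·log P·𝔓 + O(𝓛²𝔓)` under Prop 7.1, Lemma 8.1, Prop 2.2 (i),
# Lemma 2.3 (the UNITS lemma behind the band slot E-004)

Y. Zhang, *Discrete mean estimates and the Landau–Siegel zero*, arXiv:2211.02515v1 [Zhang2022LandauSiegel] —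
an unrefereed manuscript under adjudication. **WHAT THIS IS NOT: not a claim about Theorems 1–2 of
arXiv:2211.02515, about Landau–Siegel zeros, or about Parity; every hypothesis below (`Prop71`, `Lemma81`, `Prop22i`,
`Lemma23`) is a CLAIM OF THE MANUSCRIPT, displayed, never asserted. The programme SEARCHES and TYPES.**

**What is proved (kernel, conditional on the four displayed nodes).** The total absolute weight of the discrete mean,
`discWeight c′ χ = Σ_{(ψ,ρ)} |Re 𝔠*(ρ,ψ)·Re ω(ρ)|` (`Repair.discWeight`, p455670; `= KnifeEdge.discWeight`, p456081:
`KnifeEdge.discWeight_eq_repair`), equals — weights being real and `≥ 0` under Lemma 2.3 / Prop 2.2 (i) — the TOTAL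
MASS `ΣΣ𝔠*ω` (`sum_cstar_omega_eq_discWeight`), i.e. the left side of Lemma 8.1 at the unit pair `𝐚₁ = 𝐚₂ = δ₁`
(`Section11Deductions.lhs81_delta1`, where the tree's §11 file already proves `S_j(δ₁,δ₁) = 1`, `E(δ₁,δ₁) = 3𝓛²𝔓` and
the UPPER bound `ΣΣ𝔠*ω ≪ 𝓛⁹𝔓`, `totalMass_le`). Here the main term is evaluated EXACTLY,
`mainMV(δ₁,δ₁) = α⁻¹(½ + 2 + 3/2)𝔓 = (4/π)·𝓛⁹·𝔓` (`mainMV_delta1`), whence (`discWeight_trivialScale`): for every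
`ε > 0` there is `C` with, for all large `D` under (A), `|discWeight − (8/π)·𝓛⁹·𝔓| ≤ (C·𝓛² + ε)·𝔓`; in particular
(`discWeight_trivialScale_window`) `2·𝓛⁹·𝔓 ≤ discWeight ≤ 3·𝓛⁹·𝔓` eventually. Since every main term of the method is
`𝔠·𝔞𝔓` (Eval823/97/181) with `𝔞 = (6/π²)L′(1,χ)²∏q/(q+1) ≤ L′(1,χ)² ≪ 𝓛⁴`, the trivial scale exceeds the main
scale by `≫ 𝓛⁵`: a bound `C·w·discWeight` at fixed `w` (the typed E-004 forms `Repair.DiscMeanBandWidth(On/Wall0)`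
p457769/p458872, `KnifeEdge.DiscMeanUpperWidth` p457290) is NOT an `o(𝔞𝔓)` statement; the main-scale twin is
`Repair.DiscMeanBandMain` (RepairBandSlotMain.lean). Kernel form of the theory custodian's sentence «regular part
≍ 𝔞𝓛⁻⁹ of the trivial scale» (zhang-knife bus 2026-08-26T11:35:37Z).

References: Zhang, arXiv:2211.02515v1, §2 (2.9), (2.14)–(2.16), (2.31), Lemma 2.3, Prop. 2.2; §7 Prop 7.1, (7.2);
§8 Lemma 8.1; §11 p. 64 [cite: Zhang2022LandauSiegel, §§2, 7, 8, 11].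
-/

noncomputable section

open Complex Real ComplexConjugate

namespace Literature.NumberTheory.LFunctions.Zhang2022

namespace Skeleton

open Section11Deductions

variable (c' : ℝ) {D : ℕ}

/-- **The main term of Prop. 7.1 at `(δ₁,δ₁)` is `α⁻¹(½ + 2 + 3/2)𝔓 = (4/π)·𝓛⁹·𝔓` EXACTLY** (`α = π/log P`,
`log P = 𝓛⁹`; `S_j(δ₁,δ₁) = 1`, `Section11Deductions.Sj_delta1`). [cite: Zhang2022LandauSiegel, §7 Prop 7.1, §2 (2.6)] -/
theorem mainMV_delta1 (hD : 2 ≤ Real.log D) :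
    mainMV c' D (Pi.single 1 1) (Pi.single 1 1) = ((4 / π * ell D ^ 9 * frakP D : ℝ) : ℂ) := by
  have hα : alpha D = π / ell D ^ 9 := by rw [alpha, bigP, Real.log_exp]
  have hℓ : 0 < ell D := by rw [ell]; linarith
  rw [mainMV, Sj_delta1 c' hD, Sj_delta1 c' hD, Sj_delta1 c' hD, hα]
  have hπ : (π : ℂ) ≠ 0 := by exact_mod_cast Real.pi_ne_zero
  have hℓ' : ((ell D : ℝ) : ℂ) ≠ 0 := by exact_mod_cast hℓ.ne'
  push_cast
  field_simp
  ring

variable [NeZero D] (χ : DirichletCharacter ℂ D)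

/-- Under Lemma 2.3 and Prop 2.2 (i) at `(D, χ)` (weights real and `≥ 0`), the total mass `ΣΣ𝔠*ω` IS `discWeight`
(as a complex number). [cite: Zhang2022LandauSiegel, §2 Lemma 2.3, Prop. 2.2 (i), (2.15)] -/
theorem sum_cstar_omega_eq_discWeight (hD : 3 ≤ D)
    (h23 : ∀ x ∈ PsiOne χ, ∀ ρ ∈ zeroSet D x, (cstar c' D x ρ).im = 0 ∧ 0 ≤ (cstar c' D x ρ).re)
    (h22 : ∀ x ∈ PsiOne χ, ∀ s ∈ prodZeroSetOmega χ x, s.re = 1 / 2) :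
    ∑ i ∈ idx χ, cstar c' D i.1 i.2 * omegaW D i.2 = ((Repair.discWeight c' χ : ℝ) : ℂ) := by
  unfold Repair.discWeight
  push_cast
  refine Finset.sum_congr rfl fun i hi => ?_
  obtain ⟨h1, h2⟩ := mem_idx χ hi
  have hre : i.2.re = 1 / 2 := h22 i.1 h1 i.2 (mem_prodZeroSetOmega_of_mem_zeroSet χ h2)
  obtain ⟨hcim, hcre⟩ := h23 i.1 h1 i.2 h2
  obtain ⟨hωre, hωim⟩ := omegaW_re_pos hD hre
  have hc : cstar c' D i.1 i.2 = ((cstar c' D i.1 i.2).re : ℂ) :=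
    Complex.ext (by simp) (by simp [hcim])
  have hω : omegaW D i.2 = ((omegaW D i.2).re : ℂ) := Complex.ext (by simp) (by simp [hωim])
  rw [abs_of_nonneg (mul_nonneg hcre hωre.le), Complex.ofReal_mul]
  conv_lhs => rw [hc, hω]

/-- `⌈exp L₀⌉ ≤ D` gives `L₀ ≤ 𝓛`. [folklore] -/
private theorem le_ell_of_ceil_exp_le {L₀ : ℝ} {D : ℕ} (hD : ⌈Real.exp L₀⌉₊ ≤ D) : L₀ ≤ ell D := by
  have h : Real.exp L₀ ≤ (D : ℝ) := (Nat.le_ceil _).trans (by exact_mod_cast hD)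
  exact (Real.le_log_iff_exp_le (lt_of_lt_of_le (Real.exp_pos _) h)).mpr h

/-- Eventually `D ≥ 3` and `𝓛 ≥ L₀`, for any fixed `L₀ ≥ 2`. [folklore] -/
private theorem forAllLarge_ell_ge {L₀ : ℝ} (hL₀ : 2 ≤ L₀) :
    ForAllLarge fun D _ _ => 3 ≤ D ∧ L₀ ≤ ell D := by
  refine ForAllLarge.of_le ⌈Real.exp L₀⌉₊ fun D _ _ hD _ _ => ⟨?_, le_ell_of_ceil_exp_le hD⟩
  have h3 : (3 : ℝ) ≤ Real.exp L₀ := le_trans (by linarith) (Real.add_one_le_exp _)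
  have : (3 : ℝ) ≤ D := (h3.trans (Nat.le_ceil _)).trans (by exact_mod_cast hD)
  exact_mod_cast this

/-- **THE UNITS LEMMA.** Under Prop. 7.1, Lemma 8.1, Prop. 2.2 (i) and Lemma 2.3 (all displayed CLAIMS of the
manuscript): for every `ε > 0` there is `C` such that for all large `D`, every real primitive `χ (mod D)` with (A),
`|discWeight c′ χ − (8/π)·𝓛⁹·𝔓| ≤ (C·𝓛² + ε)·𝔓` — the trivial scale of the discrete mean is `(8/π)·log P·𝔓·(1 + o(1))`.
[cite: Zhang2022LandauSiegel, §7 Prop 7.1, §8 Lemma 8.1, §2 Lemma 2.3] -/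
theorem discWeight_trivialScale (h71 : Prop71 c') (h81 : Lemma81 c') (h22 : Prop22i) (h23 : Lemma23 c') :
    ∀ ε : ℝ, 0 < ε → ∃ C : ℝ, ForAllLarge fun D _ χ => AssumptionA D χ →
      |Repair.discWeight c' χ - 8 / π * ell D ^ 9 * frakP D| ≤ (C * ell D ^ 2 + ε) * frakP D := by
  intro ε hε
  obtain ⟨C, hC⟩ := h71 1 (ε / 3) (by positivity)
  refine ⟨6 * C, ?_⟩
  have h81' := h81 1 (ε / 3) (by positivity)
  refine ((((hC.and h81').and h22).and h23).and (forAllLarge_ell_ge (L₀ := 2) le_rfl)).mono ?_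
  intro D _ χ hq hp h hA
  obtain ⟨⟨⟨⟨h71D, h81D⟩, h22D⟩, h23D⟩, hD3, hL⟩ := h
  have hlog : 2 ≤ Real.log D := hL
  have hadm : Adm72 D 1 (Pi.single 1 1 : ℕ → ℂ) := adm72_delta1 hlog
  have e71 := h71D hA _ _ hadm hadm
  have e81 := h81D hA _ _ hadm hadm
  rw [conj_single_one, lhs81_delta1 c' χ hlog, sum_cstar_omega_eq_discWeight c' χ hD3 h23D h22D] at e81
  rw [Ecal_delta1 c' hlog, mainMV_delta1 c' hlog] at e71
  set T := Theta1 c' χ (Pi.single 1 1) (Pi.single 1 1) with hT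
  set m : ℝ := 4 / π * ell D ^ 9 * frakP D with hm
  have hP : 0 ≤ frakP D := frakP_nonneg D
  have e71' : ‖(starRingEnd ℂ) T - (m : ℂ)‖ ≤ C * (3 * ell D ^ 2 * frakP D) + ε / 3 * frakP D := by
    rw [← Complex.norm_conj, map_sub, Complex.conj_conj, Complex.conj_ofReal]; exact e71
  have key : ‖((Repair.discWeight c' χ : ℝ) : ℂ) - ((2 * m : ℝ) : ℂ)‖ ≤
      ε / 3 * frakP D + 2 * (C * (3 * ell D ^ 2 * frakP D) + ε / 3 * frakP D) := by
    calc ‖((Repair.discWeight c' χ : ℝ) : ℂ) - ((2 * m : ℝ) : ℂ)‖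
        = ‖(((Repair.discWeight c' χ : ℝ) : ℂ) - (T + (starRingEnd ℂ) T)) +
            ((T - (m : ℂ)) + ((starRingEnd ℂ) T - (m : ℂ)))‖ := by push_cast; ring_nf
      _ ≤ ‖((Repair.discWeight c' χ : ℝ) : ℂ) - (T + (starRingEnd ℂ) T)‖ +
            (‖T - (m : ℂ)‖ + ‖(starRingEnd ℂ) T - (m : ℂ)‖) :=
          (norm_add_le _ _).trans (add_le_add le_rfl (norm_add_le _ _))
      _ ≤ _ := by linarith [e81, e71, e71']
  rw [← Complex.ofReal_sub, Complex.norm_real, Real.norm_eq_abs] at key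
  have : 2 * m = 8 / π * ell D ^ 9 * frakP D := by rw [hm]; ring
  rw [this] at key
  calc |Repair.discWeight c' χ - 8 / π * ell D ^ 9 * frakP D|
      ≤ ε / 3 * frakP D + 2 * (C * (3 * ell D ^ 2 * frakP D) + ε / 3 * frakP D) := key
    _ = (6 * C * ell D ^ 2 + ε) * frakP D := by ring

/-- **Corollary: `2·𝓛⁹·𝔓 ≤ discWeight ≤ 3·𝓛⁹·𝔓` eventually** (under the same four displayed nodes and (A)).
Every main term of the method is `𝔠·𝔞𝔓` with `𝔞 ≤ L′(1,χ)² ≪ 𝓛⁴`, so `discWeight` exceeds the main scale by `≫ 𝓛⁵`: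
a bound `C·w·discWeight` at fixed `w` is not an `o(𝔞𝔓)` statement. [cite: Zhang2022LandauSiegel, §7 Prop 7.1, §8 Lemma 8.1] -/
theorem discWeight_trivialScale_window (h71 : Prop71 c') (h81 : Lemma81 c') (h22 : Prop22i)
    (h23 : Lemma23 c') :
    ForAllLarge fun D _ χ => AssumptionA D χ →
      2 * ell D ^ 9 * frakP D ≤ Repair.discWeight c' χ ∧ Repair.discWeight c' χ ≤ 3 * ell D ^ 9 * frakP D := by
  obtain ⟨C, hC⟩ := discWeight_trivialScale c' h71 h81 h22 h23 1 one_pos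
  refine (hC.and (forAllLarge_ell_ge (L₀ := 3 * (|C| + 1) + 1)
    (by have := abs_nonneg C; linarith))).mono ?_
  intro D _ χ _ _ h hA
  obtain ⟨hCD, -, hLD⟩ := h
  obtain ⟨hlo, hhi⟩ := abs_le.mp (hCD hA)
  have hP : 0 ≤ frakP D := frakP_nonneg D
  have hπpos : (0:ℝ) < π := Real.pi_pos
  have hπlo : 1 / 2 ≤ 8 / π - 2 := by
    rw [div_sub' (ne_of_gt hπpos), le_div_iff₀ hπpos]; nlinarith [Real.pi_lt_d2]
  have hπhi : 8 / π ≤ 3 - 9 / 20 := by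
    rw [div_le_iff₀ hπpos]; nlinarith [Real.pi_gt_d2]
  have hℓ1 : 1 ≤ ell D := by have := abs_nonneg C; linarith
  have hC' : C ≤ |C| := le_abs_self C
  have hAbs := abs_nonneg C
  -- the polynomial slack: `C𝓛² + 1 ≤ (9/20)·𝓛⁹`
  have h1 : C * ell D ^ 2 + 1 ≤ (|C| + 1) * ell D ^ 2 := by nlinarith [one_le_pow₀ (n := 2) hℓ1]
  have h2 : (|C| + 1) * ell D ^ 2 ≤ 9 / 20 * ell D * ell D ^ 2 := by nlinarith
  have h3 : 9 / 20 * ell D * ell D ^ 2 ≤ 9 / 20 * ell D ^ 9 := by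
    have : ell D * ell D ^ 2 = ell D ^ 3 := by ring
    rw [mul_assoc, this]
    exact mul_le_mul_of_nonneg_left (pow_le_pow_right₀ hℓ1 (by norm_num)) (by norm_num)
  have hslack : (C * ell D ^ 2 + 1) * frakP D ≤ 9 / 20 * ell D ^ 9 * frakP D :=
    mul_le_mul_of_nonneg_right (h1.trans (h2.trans h3)) hP
  have h9P : 0 ≤ ell D ^ 9 * frakP D := by positivity
  constructor
  · nlinarith [mul_le_mul_of_nonneg_right hπlo h9P]
  · nlinarith [mul_le_mul_of_nonneg_right hπhi h9P]

end Skeleton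

/-- The two discrete-mean vocabularies have the same total absolute weight: `KnifeEdge.discWeight = Repair.discWeight`
(so the units lemma applies verbatim to B-len's E-004 forms `KnifeEdge.DiscMeanUpperWidth` &c.).
[cite: Zhang2022LandauSiegel, §2 (2.16)] -/
theorem KnifeEdge.discWeight_eq_repair (c' : ℝ) {D : ℕ} (χ : DirichletCharacter ℂ D) :
    KnifeEdge.discWeight c' χ = Repair.discWeight c' χ := rfl

end Literature.NumberTheory.LFunctions.Zhang2022

end
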